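import Summits.Ventures.CertifiedArithmetic.LowPrec.RoundToOdd

/-!
# Round to odd is monotone

HONEST FRAMING (venture CertifiedArithmetic / cell `pub-lowprec`): certified error envelopes and
provably optimal rounding/accumulation schemes for low-precision formats under stated cost models;
every table by two implementations; no hardware or vendor claims.

[BoldoMelquiond2008, Thm 2] lists the properties of rounding to odd that make it a rounding mode in
Coq/Flocq's sense: total, faithful ("MinOrMax"), MONOTONE, symmetric. `RoundToOdd.lean` proved
faithful / exact / symmetric / odd-when-inexact for the venture's `roundOdd φ` (every format); this
file adds MONOTONICITY on the finite range: `x ≤ y`, `|x|, |y| ≤ maxRat φ` ⟹ `RO(x) ≤ RO(y)`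
(`toRat_roundOdd_mono`, every format). Proof: two arguments in different cells of the value grid are
ordered by the cell endpoints; two inexact arguments in the SAME cell `(v, v + ulp v)` have the same
`roundDown` datum, hence the same parity decision, hence the same result.
-/

namespace Literature.ComputerArithmetic.FloatingPoint

namespace MiniFloat

open Format

variable {φ : Format}

/-- `roundUp` returns every in-range value unchanged. [folklore] -/
theorem toRat_roundUp_of_exists {t : ℚ} (ht : |t| ≤ φ.maxRat) (h : ∃ y : MiniFloat φ, y.toRat = t) :
    (roundUp φ t).toRat = t := by
  obtain ⟨y, hy⟩ := h
  have h1 := le_toRat_roundUp ht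
  have h2 := roundUp_le_toRat ht y hy.ge
  linarith

/-- For `t ≥ 0` the trailing significand of `roundDown φ t` depends only on the VALUE of
`roundDown φ t` (it is `manOf` of the magnitude). [folklore] -/
theorem man_roundDown_eq_of_toRat_eq {t t' : ℚ} (ht : 0 ≤ t) (ht' : 0 ≤ t')
    (h : (roundDown φ t).toRat = (roundDown φ t').toRat) :
    (roundDown φ t).man = (roundDown φ t').man := by
  have hq := φ.quantum_pos
  have hgrid : φ.rdGrid (|t| / φ.quantum) = φ.rdGrid (|t'| / φ.quantum) := by
    rw [toRat_roundDown, toRat_roundDown, if_neg (not_lt.mpr ht), if_neg (not_lt.mpr ht')] at h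
    have := mul_right_cancel₀ hq.ne' h
    exact_mod_cast this
  unfold roundDown
  rw [if_neg (not_lt.mpr ht), if_neg (not_lt.mpr ht')]
  show φ.manOf (φ.rdGrid (|t| / φ.quantum)) = φ.manOf (φ.rdGrid (|t'| / φ.quantum))
  rw [hgrid]

/-- MONOTONICITY OF ROUND TO ODD on nonnegative in-range arguments (every format).
[cite: BoldoMelquiond2008, Thm 2] -/
theorem toRat_roundOddPos_mono {t t' : ℚ} (ht0 : 0 ≤ t) (htt' : t ≤ t')
    (ht' : t' ≤ φ.maxRat) : (roundOddPos φ t).toRat ≤ (roundOddPos φ t').toRat := by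
  have ht'0 : 0 ≤ t' := le_trans ht0 htt'
  have ht1 : t ≤ φ.maxRat := le_trans htt' ht'
  have habs : |t| ≤ φ.maxRat := by rw [abs_of_nonneg ht0]; exact ht1
  have habs' : |t'| ≤ φ.maxRat := by rw [abs_of_nonneg ht'0]; exact ht'
  obtain ⟨hlo, hhi⟩ := roundDown_le_roundOddPos_le_roundUp (φ := φ) habs
  obtain ⟨hlo', hhi'⟩ := roundDown_le_roundOddPos_le_roundUp (φ := φ) habs'
  have hRD := toRat_roundDown_mono (φ := φ) htt' habs habs'
  have hRU := toRat_roundUp_mono (φ := φ) htt' habs habs'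
  by_contra hlt
  have hlt : (roundOddPos φ t').toRat < (roundOddPos φ t).toRat := not_le.mp hlt
  -- neither argument is a value
  have hnt : ¬ ∃ y : MiniFloat φ, y.toRat = t := by
    intro h
    have h1 := toRat_roundOddPos_of_exists habs h
    have h2 := toRat_roundDown_of_exists habs h
    linarith
  have hnt' : ¬ ∃ y : MiniFloat φ, y.toRat = t' := by
    intro h
    have h1 := toRat_roundOddPos_of_exists habs' h
    have h2 := toRat_roundUp_of_exists habs' h
    linarith
  have htpos : 0 < t := lt_of_le_of_ne ht0 (fun h => hnt ⟨MiniFloat.zero φ, by rw [toRat_zero]; exact h⟩)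
  have ht'lt : t' < φ.maxRat := lt_of_le_of_ne ht' (fun h => hnt' ⟨top φ, by rw [toRat_top, h]⟩)
  have htlt : t < φ.maxRat := lt_of_le_of_lt htt' ht'lt
  have ht'pos : 0 < t' := lt_of_lt_of_le htpos htt'
  -- the two brackets
  obtain ⟨hv0, hvs, hsu, ⟨u, hu⟩, hgap⟩ := roundDown_bracket htpos htlt hnt
  obtain ⟨hv0', hvs', hsu', ⟨u', hu'⟩, hgap'⟩ := roundDown_bracket ht'pos ht'lt hnt'
  set v := roundDown φ t with hv
  set v' := roundDown φ t' with hv'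
  set G := (2 : ℚ) ^ (v.expCode - 1) * φ.quantum with hG
  set G' := (2 : ℚ) ^ (v'.expCode - 1) * φ.quantum with hG'
  have hRUt : (roundUp φ t).toRat = v.toRat + G := by
    have h1 : t ≤ (roundUp φ t).toRat := le_toRat_roundUp habs
    have h2 : (roundUp φ t).toRat ≤ u.toRat := roundUp_le_toRat habs u (by rw [hu]; exact hsu.le)
    rcases hgap (roundUp φ t) with h | h
    · exfalso; linarith
    · rw [hu] at h2; exact le_antisymm h2 h
  have hRUt' : (roundUp φ t').toRat = v'.toRat + G' := by
    have h1 : t' ≤ (roundUp φ t').toRat := le_toRat_roundUp habs'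
    have h2 : (roundUp φ t').toRat ≤ u'.toRat := roundUp_le_toRat habs' u' (by rw [hu']; exact hsu'.le)
    rcases hgap' (roundUp φ t') with h | h
    · exfalso; linarith
    · rw [hu'] at h2; exact le_antisymm h2 h
  rcases lt_or_eq_of_le hRD with hvlt | hveq
  · -- different cells: `v' ≥ v + G = RU t ≥ RO t`, contradiction
    have h1 : v.toRat + G ≤ v'.toRat := by
      rcases hgap v' with h | h
      · exfalso; linarith
      · exact h
    linarith
  · -- same cell: `v = v'` as values, hence `v + G = v' + G'`, same `roundDown` parity, same result
    have hGpos : (0:ℚ) < G := by rw [hG]; exact mul_pos (by positivity) φ.quantum_pos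
    have hG'pos : (0:ℚ) < G' := by rw [hG']; exact mul_pos (by positivity) φ.quantum_pos
    have hcell : v.toRat + G = v'.toRat + G' := by
      apply le_antisymm
      · -- `u' = v' + G'` is a value above `v = v'`, hence `≥ v + G`; and symmetrically
        rcases hgap u' with h | h
        · exfalso; rw [hu'] at h; linarith
        · rw [hu'] at h; exact h
      · rcases hgap' u with h | h
        · exfalso; rw [hu] at h; linarith
        · rw [hu] at h; exact h
    have hman : v.man = v'.man := man_roundDown_eq_of_toRat_eq ht0 ht'0 hveq
    -- unfold the two parity decisions
    have hne : (roundDown φ t).toRat ≠ t := fun h => hnt ⟨_, h⟩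
    have hne' : (roundDown φ t').toRat ≠ t' := fun h => hnt' ⟨_, h⟩
    have hRO : (roundOddPos φ t).toRat = if 2 ∣ v.man then v.toRat + G else v.toRat := by
      unfold roundOddPos; rw [if_neg hne]
      split
      · exact hRUt
      · rfl
    have hRO' : (roundOddPos φ t').toRat = if 2 ∣ v'.man then v'.toRat + G' else v'.toRat := by
      unfold roundOddPos; rw [if_neg hne']
      split
      · exact hRUt'
      · rfl
    rw [hRO, hRO', ← hman, ← hcell, ← hveq] at hlt
    split at hlt <;> exact lt_irrefl _ hlt

/-- `RO` of a nonnegative in-range argument is nonnegative. [folklore] -/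
theorem toRat_roundOddPos_nonneg {t : ℚ} (ht0 : 0 ≤ t) (ht : t ≤ φ.maxRat) :
    0 ≤ (roundOddPos φ t).toRat := by
  have habs : |t| ≤ φ.maxRat := by rw [abs_of_nonneg ht0]; exact ht
  have h := le_roundOddPos_of_le habs (MiniFloat.zero φ) (by rw [toRat_zero]; exact ht0)
  rwa [toRat_zero] at h

/-- **ROUND TO ODD IS MONOTONE** on the finite range (every format): `x ≤ y`, `|x| ≤ maxRat`,
`|y| ≤ maxRat` ⟹ `RO(x) ≤ RO(y)` as values. [cite: BoldoMelquiond2008, Thm 2] -/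
theorem toRat_roundOdd_mono {x y : ℚ} (hxy : x ≤ y) (hx : |x| ≤ φ.maxRat)
    (hy : |y| ≤ φ.maxRat) : (roundOdd φ x).toRat ≤ (roundOdd φ y).toRat := by
  have hx' := abs_le.mp hx
  have hy' := abs_le.mp hy
  rcases le_or_gt 0 x with hx0 | hx0
  · -- both nonnegative
    rw [roundOdd_of_nonneg hx0, roundOdd_of_nonneg (le_trans hx0 hxy)]
    exact toRat_roundOddPos_mono hx0 hxy hy'.2
  · rcases le_or_gt 0 y with hy0 | hy0
    · -- `x < 0 ≤ y`
      have h1 : (roundOdd φ x).toRat ≤ 0 := by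
        have h := toRat_roundOdd_neg (φ := φ) (-x)
        rw [neg_neg] at h
        rw [h, neg_nonpos, roundOdd_of_nonneg (by linarith : 0 ≤ -x)]
        exact toRat_roundOddPos_nonneg (by linarith) (by linarith)
      have h2 : 0 ≤ (roundOdd φ y).toRat := by
        rw [roundOdd_of_nonneg hy0]; exact toRat_roundOddPos_nonneg hy0 hy'.2
      linarith
    · -- both negative: `RO(x) = -RO(-x)` and `-y ≤ -x`
      have ex : (roundOdd φ x).toRat = -(roundOddPos φ (-x)).toRat := by
        have h := toRat_roundOdd_neg (φ := φ) (-x)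
        rw [neg_neg] at h; rw [h, roundOdd_of_nonneg (by linarith : 0 ≤ -x)]
      have ey : (roundOdd φ y).toRat = -(roundOddPos φ (-y)).toRat := by
        have h := toRat_roundOdd_neg (φ := φ) (-y)
        rw [neg_neg] at h; rw [h, roundOdd_of_nonneg (by linarith : 0 ≤ -y)]
      rw [ex, ey, neg_le_neg_iff]
      exact toRat_roundOddPos_mono (by linarith) (by linarith) (by linarith)

end MiniFloat

end Literature.ComputerArithmetic.FloatingPoint
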